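import Summits.ResolutionOfSingularities.ResolutionOfSingularities.Theorems.PurelyInseparableDim4ResConeDInfTT
import Summits.ResolutionOfSingularities.ResolutionOfSingularities.Theorems.PurelyInseparableDim4ResConeSatellitePair
import HarnessLib
import HarnessLib.Audit.Tags

/-!
# Purely inseparable four-folds — AT A TIME FOLLOWED BY A SATELLITE STEP THE POLAR KERNEL IS SPANNED BY THE TWO DIRECTIONS; every other
# untranslated letter is a CONE letter there (K2(p) lane, slice C; every prime, every shade; seat res-dim4-p-1 g6)

[OURS · counted 0 · cell `res-dim4-pi` · K2(p) lane (holder res-dim4-p-12 g5; row E-TRANS = res-dim4-p-9 g5's `…PermanentConeLetter`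
(`coneLetter_of_permanent`, first stamp 2026-08-29 10:19:51Z); this file = the SPAN FORM of the same plane-geometry fact, filed at p-9's «yes»
(bus 10:25:42Z) as a ledger-visible filter for the residue automata / SH-7) · seat res-dim4-p-1 g6.]  Nothing here proves K2(p), any TAIL(7, d, e),
`NoIsolatedTrap p p`, the Cossart–Jannsen–Saito theorem or resolution of singularities in dimension ≥ 4 / characteristic `p` — NOT proved;
statements about OUR frame's hypothetical `Step0 p` chains.  AI kernel work, weaker than expert review.

THE FACT.  On a witnessed isolated above-floor `Step0 p` chain with `x^{r₀} ∣ F₀`, constant shade and `e_G ≡ 2` from `k₀`, let step `k + 1` be a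
SATELLITE step (`j (k+1) ≠ j k`, `x_{j k}` untranslated).  The current direction `d_k = e_{j k} + b k` lies in `Vtx_k` (`chain_direction_mem_resVertex`)
with `(d_k)_{j k} = 1`, and res-dim4-p-5's `inf_hyperplane_eq_span_direction_of_satellite` (p707227) says `Vtx_k ∩ H_{j k} = K · d_{k+1}`.  Hence:
* **`mem_resVertex_of_satellite`** — every `v ∈ Vtx_k` is `v_{j k} • d_k + t • d_{k+1}`; **`resVertex_eq_span_directions_of_satellite`** —
  `Vtx_k = K·d_k ⊔ K·d_{k+1}`;
* **`coneLetter_of_satellite`** — every letter `z ∉ {j k, j (k+1)}` with `b k z = b (k+1) z = 0` is a CONE LETTER at time `k` (every kernel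
  vector vanishes at `z`) — ACTIVE kept letters included (for a PERMANENT letter this is p-9's `coneLetter_of_permanent` at the satellite times);
* `apply_eq_zero_of_satellite_of_forall` — packaged: if both translations `b k`, `b (k+1)` vanish off a set `T ⊇ {j k, j (k+1)}`, the kernel at
  `k` is supported on `T`.
LEDGER READING: at a satellite pair every boundary letter other than the two charts and the translated ones is a cone letter; with res-dim4-p-11
g5's `newborn_transversal` (the newborn is never a cone letter) two consecutive satellite steps force the third step to chart or translate the
first newborn.
[cite: CossartJannsenSaito2020, Thm. 3.10(4), Thm. 3.14, Thm. 9.3] [cite: Hauser2010, §§F–G (chart expressions of a point blowup; cleaning)]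
bears_on: LADDER-RESOLUTION:D157-DOOR2 (res-dim4-pi · K2(p) = `RidgeBudget.NoAboveFloorTrap p p` · slice C · kernel = span of the two directions
at a satellite time).  Supports stmt-ResolutionOfSingularities-16155 (helper).
-/

set_option linter.dupNamespace false -- mandated namespace of this single-conjunct summit

noncomputable section

namespace Summit.ResolutionOfSingularities.ResolutionOfSingularities.Theorems.PIDim4

namespace ResCone

open MvPolynomial Finset
open Literature.AlgebraicGeometry.Resolution
open Literature.AlgebraicGeometry.Resolution.CentreBlowup
open Literature.AlgebraicGeometry.Resolution.Hauser2010
open Literature.AlgebraicGeometry.Resolution.HauserPerlega2019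
open PointBlowup (direction)

variable {K : Type} [Field K] [DecidableEq K] (p : ℕ) [Fact p.Prime]

/-- **AT A TIME FOLLOWED BY A SATELLITE STEP EVERY KERNEL VECTOR IS `v_{j k} • d_k + t • d_{k+1}`** (constant-`(d, e_G = 2)` tail).
[OURS] [cite: CossartJannsenSaito2020, Thm. 3.10(4), Thm. 3.14, Thm. 9.3] -/
theorem mem_resVertex_of_satellite {c : ℕ → State K} {j : ℕ → Fin 4} {b : ℕ → Fin 4 → K}
    (hc : ∀ k, IsIsolated p (c k).F ∧ Step0 p (c k) (c (k + 1))) (hw : FreeTail.IsWitnessedChain p c j b)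
    (hr0 : ∀ e ∈ (c 0).F.support, (c 0).r ≤ e) (hfloor : ∀ k, ordZero (c k).F ≠ p) {k₀ : ℕ} {d : ℕ∞}
    (hshade : ∀ k, k₀ ≤ k → (c k).shade = d) (he : ∀ k, k₀ ≤ k → Module.finrank K (resVertex (c k)) = 2)
    {k : ℕ} (hk : k₀ ≤ k) (hsat : FreeTail.IsSatellite j b k) {v : Fin 4 → K} (hv : v ∈ resVertex (c k)) :
    ∃ t : K, v = v (j k) • direction (j k) (b k) + t • direction (j (k + 1)) (b (k + 1)) := by
  have hdk := chain_direction_mem_resVertex p hc hw hr0 hfloor hshade hk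
  set w : Fin 4 → K := v - v (j k) • direction (j k) (b k) with hwdef
  have hwV : w ∈ resVertex (c k) := Submodule.sub_mem _ hv (Submodule.smul_mem _ _ hdk)
  have hwj : w (j k) = 0 := by
    rw [hwdef, Pi.sub_apply, Pi.smul_apply, direction_apply_self, smul_eq_mul, mul_one, sub_self]
  have hmem : w ∈ resVertex (c k) ⊓ hyperplane (j k) := Submodule.mem_inf.mpr ⟨hwV, mem_hyperplane.mpr hwj⟩
  rw [inf_hyperplane_eq_span_direction_of_satellite p hc hw hr0 hfloor hshade he hk hsat, Submodule.mem_span_singleton] at hmem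
  obtain ⟨t, ht⟩ := hmem
  exact ⟨t, by rw [ht, hwdef, add_sub_cancel]⟩

/-- **THE KERNEL IS THE SPAN OF THE TWO DIRECTIONS** at a time followed by a satellite step (constant-`(d, e_G = 2)` tail):
`Vtx_k = K·d_k ⊔ K·d_{k+1}`. [OURS] [cite: CossartJannsenSaito2020, Thm. 3.10(4), Thm. 3.14, Thm. 9.3] -/
theorem resVertex_eq_span_directions_of_satellite {c : ℕ → State K} {j : ℕ → Fin 4} {b : ℕ → Fin 4 → K}
    (hc : ∀ k, IsIsolated p (c k).F ∧ Step0 p (c k) (c (k + 1))) (hw : FreeTail.IsWitnessedChain p c j b)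
    (hr0 : ∀ e ∈ (c 0).F.support, (c 0).r ≤ e) (hfloor : ∀ k, ordZero (c k).F ≠ p) {k₀ : ℕ} {d : ℕ∞}
    (hshade : ∀ k, k₀ ≤ k → (c k).shade = d) (he : ∀ k, k₀ ≤ k → Module.finrank K (resVertex (c k)) = 2)
    {k : ℕ} (hk : k₀ ≤ k) (hsat : FreeTail.IsSatellite j b k) :
    resVertex (c k) = (K ∙ direction (j k) (b k)) ⊔ (K ∙ direction (j (k + 1)) (b (k + 1))) := by
  apply le_antisymm
  · intro v hv
    obtain ⟨t, ht⟩ := mem_resVertex_of_satellite p hc hw hr0 hfloor hshade he hk hsat hv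
    rw [ht]
    exact Submodule.add_mem _ (Submodule.mem_sup_left (Submodule.smul_mem _ _ (Submodule.mem_span_singleton_self _)))
      (Submodule.mem_sup_right (Submodule.smul_mem _ _ (Submodule.mem_span_singleton_self _)))
  · have hdk := chain_direction_mem_resVertex p hc hw hr0 hfloor hshade hk
    have hdk1 : direction (j (k + 1)) (b (k + 1)) ∈ resVertex (c k) := by
      have h : direction (j (k + 1)) (b (k + 1)) ∈ resVertex (c k) ⊓ hyperplane (j k) := by
        rw [inf_hyperplane_eq_span_direction_of_satellite p hc hw hr0 hfloor hshade he hk hsat]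
        exact Submodule.mem_span_singleton_self _
      exact (Submodule.mem_inf.mp h).1
    exact sup_le ((Submodule.span_singleton_le_iff_mem _ _).mpr hdk) ((Submodule.span_singleton_le_iff_mem _ _).mpr hdk1)

/-- **CONE LETTERS AT A TIME FOLLOWED BY A SATELLITE STEP**: every letter `z ∉ {j k, j (k+1)}` translated at neither step (`b k z = 0`,
`b (k+1) z = 0`) is a CONE LETTER at time `k` — every kernel vector vanishes at `z`.  Kept ACTIVE letters included; for a permanent letter this is
res-dim4-p-9 g5's `coneLetter_of_permanent` at the satellite times. [OURS] [cite: CossartJannsenSaito2020, Thm. 3.10(4), Thm. 3.14, Thm. 9.3] -/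
theorem coneLetter_of_satellite {c : ℕ → State K} {j : ℕ → Fin 4} {b : ℕ → Fin 4 → K}
    (hc : ∀ k, IsIsolated p (c k).F ∧ Step0 p (c k) (c (k + 1))) (hw : FreeTail.IsWitnessedChain p c j b)
    (hr0 : ∀ e ∈ (c 0).F.support, (c 0).r ≤ e) (hfloor : ∀ k, ordZero (c k).F ≠ p) {k₀ : ℕ} {d : ℕ∞}
    (hshade : ∀ k, k₀ ≤ k → (c k).shade = d) (he : ∀ k, k₀ ≤ k → Module.finrank K (resVertex (c k)) = 2)
    {k : ℕ} (hk : k₀ ≤ k) (hsat : FreeTail.IsSatellite j b k) {z : Fin 4} (hzj : z ≠ j k) (hzj' : z ≠ j (k + 1))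
    (hbz : b k z = 0) (hbz' : b (k + 1) z = 0) : ∀ v ∈ resVertex (c k), v z = 0 := by
  intro v hv
  obtain ⟨t, ht⟩ := mem_resVertex_of_satellite p hc hw hr0 hfloor hshade he hk hsat hv
  rw [ht, Pi.add_apply, Pi.smul_apply, Pi.smul_apply, direction_apply_of_ne hzj, direction_apply_of_ne hzj', hbz, hbz',
    smul_zero, smul_zero, add_zero]

/-- **THE KERNEL IS SUPPORTED ON THE TOUCHED LETTERS**: if both translations `b k`, `b (k+1)` vanish off a letter set `T` containing the two charts
`j k, j (k+1)`, then at a time `k` followed by a satellite step every kernel vector is supported on `T`. [OURS]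
[cite: CossartJannsenSaito2020, Thm. 3.10(4), Thm. 3.14, Thm. 9.3] -/
theorem apply_eq_zero_of_satellite_of_forall {c : ℕ → State K} {j : ℕ → Fin 4} {b : ℕ → Fin 4 → K}
    (hc : ∀ k, IsIsolated p (c k).F ∧ Step0 p (c k) (c (k + 1))) (hw : FreeTail.IsWitnessedChain p c j b)
    (hr0 : ∀ e ∈ (c 0).F.support, (c 0).r ≤ e) (hfloor : ∀ k, ordZero (c k).F ≠ p) {k₀ : ℕ} {d : ℕ∞}
    (hshade : ∀ k, k₀ ≤ k → (c k).shade = d) (he : ∀ k, k₀ ≤ k → Module.finrank K (resVertex (c k)) = 2)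
    {k : ℕ} (hk : k₀ ≤ k) (hsat : FreeTail.IsSatellite j b k) {T : Finset (Fin 4)} (hjT : j k ∈ T) (hjT' : j (k + 1) ∈ T)
    (hbT : ∀ i, i ∉ T → b k i = 0) (hbT' : ∀ i, i ∉ T → b (k + 1) i = 0) :
    ∀ v ∈ resVertex (c k), ∀ z, z ∉ T → v z = 0 := fun v hv z hz =>
  coneLetter_of_satellite p hc hw hr0 hfloor hshade he hk hsat (fun h => hz (by rw [h]; exact hjT))
    (fun h => hz (by rw [h]; exact hjT')) (hbT z hz) (hbT' z hz) v hv

end ResCone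

end Summit.ResolutionOfSingularities.ResolutionOfSingularities.Theorems.PIDim4

end
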